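import Mathlib
import Summits.ResolutionOfSingularities.ResolutionOfSingularities.Theorems.WeightedInvariantLocalWeightedDropTOT2NearCurveKernel
import Summits.ResolutionOfSingularities.ResolutionOfSingularities.Theorems.WeightedInvariantLocalWeightedDropNCResSurfGraphCurveClause
import Summits.ResolutionOfSingularities.ResolutionOfSingularities.Theorems.WeightedInvariantLocalWeightedDropTOT2NearPlaneSetting

/-!
# `WeightedInvariant.LocalWeightedDrop`: NC-resolution settings for the TOT₂ line — GRAPH SURFACES, part 14: `e ≤ 2` PERSISTS ALONG THE CURVE MOVE
# (memo §9: the kernel of `Dir(in_o f̂)` at `{a, b, O}` is trivial, so the successor's directrix embeds in the `(s, u)`-plane)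

Crux item stmt-ResolutionOfSingularities-8899 `LocalWeightedDrop` (route `ResolutionOfSingularities/WeightedInvariant`), ENGINE skeleton v32/v33; S-E2-SURF
design memo `L/res-L1-w43-stub-4/g5/S-E2-SURF.md` §9.  [OURS · L1 W4.3 · chain w43 · seat res-L1-w43-stub-4 gen 5; def-free on parts 3, 12, 13, 16,
`…TOT2NearCurveKernel` and res-L1-w43-stub-1's S-SET and res-L1-w43-stub-3's S-NEAR; nothing here is a statement of any manuscript; AI-produced, gate-checked, weaker
than expert review.]

* **`apexPlane_curveTransform_of_head_eq`** — from an admissibly decorated `(b₀, δ)` with a permissible graph surface `(a, b, ψ)`, off-base boundary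
  traces divisible by `u₁`, product of apex dimension `≤ 2`: at a same-head answer `(c′, a)` of the curve move `(Φ̂, 𝟙_{≠ b})` (`c′_a ≠ 0`, `c′_b = 0`)
  with admissibly decorated successor, the successor's product has apex dimension `≤ 2`.  This DISCHARGES the hypothesis `hpers` of
  `curveMove_clause` (part 16): **`curveMove_clause'`**.
-/

set_option linter.dupNamespace false -- mandated namespace of this single-conjunct summit

noncomputable section

namespace Summit.ResolutionOfSingularities.ResolutionOfSingularities.Theorems

namespace TameFourTupleDrop

namespace GraphSurf

open MvPowerSeries Literature.AlgebraicGeometry.Resolution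

variable {k : Type} [Field k] {m : ℕ}

open Classical in
/-- **APEX DIMENSION ≤ 2 OF THE PRODUCT PERSISTS ALONG THE CURVE MOVE** (OURS · L1 W4.3; memo §9).  See the module docstring. -/
theorem apexPlane_curveTransform_of_head_eq [Infinite k] {b₀ : MvPowerSeries (Fin (m + 1)) k} {δ : Decoration k m} {a b : Fin (m + 1)}
    {ψ : Fin (m + 1) → MvPowerSeries (Fin 2) k} (hadm : Admissible b₀ δ) (hab : a ≠ b)
    (hψ : ∀ j, ¬ (j = a ∨ j = b) → constantCoeff (ψ j) = 0)
    (hE : ∀ l ∈ δ.E, ¬ (l = a ∨ l = b) → (X 0 : MvPowerSeries (Fin 2) k) ∣ ψ l)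
    (hperm : InOffPlaneIdeal a b δ.c (subst (shear a b ψ) (δ.f * ∏ l ∈ δ.O, X l)))
    (htwo : (∀ u₁ u₂ u₃ : Fin (m + 1) → k,
      (∀ v, CobordantChart.initEval (fun _ : Fin (m + 1) => 1) (v + u₁) (δ).c ((δ).f * ∏ l ∈ (δ).O, X l) =
        CobordantChart.initEval (fun _ : Fin (m + 1) => 1) v (δ).c ((δ).f * ∏ l ∈ (δ).O, X l)) →
      (∀ v, CobordantChart.initEval (fun _ : Fin (m + 1) => 1) (v + u₂) (δ).c ((δ).f * ∏ l ∈ (δ).O, X l) =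
        CobordantChart.initEval (fun _ : Fin (m + 1) => 1) v (δ).c ((δ).f * ∏ l ∈ (δ).O, X l)) →
      (∀ v, CobordantChart.initEval (fun _ : Fin (m + 1) => 1) (v + u₃) (δ).c ((δ).f * ∏ l ∈ (δ).O, X l) =
        CobordantChart.initEval (fun _ : Fin (m + 1) => 1) v (δ).c ((δ).f * ∏ l ∈ (δ).O, X l)) →
      ∃ α β γ : k, (α ≠ 0 ∨ β ≠ 0 ∨ γ ≠ 0) ∧ α • u₁ + β • u₂ + γ • u₃ = 0))
    {c' : Fin (m + 1) → k} (hca : c' a ≠ 0) (hcb : c' b = 0)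
    (hhead : (δ.transform (shear a b (fun j => if j ∈ δ.E then 0 else ψ j)) (fun j => if j = b then 0 else 1) c' a).head = δ.head)
    {b' : MvPowerSeries (Fin (m + 1)) k} (hadm' : Admissible b' (δ.transform (shear a b (fun j => if j ∈ δ.E then 0 else ψ j)) (fun j => if j = b then 0 else 1) c' a)) :
    (∀ u₁ u₂ u₃ : Fin (m + 1) → k,
      (∀ v, CobordantChart.initEval (fun _ : Fin (m + 1) => 1) (v + u₁) (δ.transform (shear a b (fun j => if j ∈ δ.E then 0 else ψ j)) (fun j => if j = b then 0 else 1) c' a).c ((δ.transform (shear a b (fun j => if j ∈ δ.E then 0 else ψ j)) (fun j => if j = b then 0 else 1) c' a).f * ∏ l ∈ (δ.transform (shear a b (fun j => if j ∈ δ.E then 0 else ψ j)) (fun j => if j = b then 0 else 1) c' a).O, X l) =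
        CobordantChart.initEval (fun _ : Fin (m + 1) => 1) v (δ.transform (shear a b (fun j => if j ∈ δ.E then 0 else ψ j)) (fun j => if j = b then 0 else 1) c' a).c ((δ.transform (shear a b (fun j => if j ∈ δ.E then 0 else ψ j)) (fun j => if j = b then 0 else 1) c' a).f * ∏ l ∈ (δ.transform (shear a b (fun j => if j ∈ δ.E then 0 else ψ j)) (fun j => if j = b then 0 else 1) c' a).O, X l)) →
      (∀ v, CobordantChart.initEval (fun _ : Fin (m + 1) => 1) (v + u₂) (δ.transform (shear a b (fun j => if j ∈ δ.E then 0 else ψ j)) (fun j => if j = b then 0 else 1) c' a).c ((δ.transform (shear a b (fun j => if j ∈ δ.E then 0 else ψ j)) (fun j => if j = b then 0 else 1) c' a).f * ∏ l ∈ (δ.transform (shear a b (fun j => if j ∈ δ.E then 0 else ψ j)) (fun j => if j = b then 0 else 1) c' a).O, X l) =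
        CobordantChart.initEval (fun _ : Fin (m + 1) => 1) v (δ.transform (shear a b (fun j => if j ∈ δ.E then 0 else ψ j)) (fun j => if j = b then 0 else 1) c' a).c ((δ.transform (shear a b (fun j => if j ∈ δ.E then 0 else ψ j)) (fun j => if j = b then 0 else 1) c' a).f * ∏ l ∈ (δ.transform (shear a b (fun j => if j ∈ δ.E then 0 else ψ j)) (fun j => if j = b then 0 else 1) c' a).O, X l)) →
      (∀ v, CobordantChart.initEval (fun _ : Fin (m + 1) => 1) (v + u₃) (δ.transform (shear a b (fun j => if j ∈ δ.E then 0 else ψ j)) (fun j => if j = b then 0 else 1) c' a).c ((δ.transform (shear a b (fun j => if j ∈ δ.E then 0 else ψ j)) (fun j => if j = b then 0 else 1) c' a).f * ∏ l ∈ (δ.transform (shear a b (fun j => if j ∈ δ.E then 0 else ψ j)) (fun j => if j = b then 0 else 1) c' a).O, X l) =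
        CobordantChart.initEval (fun _ : Fin (m + 1) => 1) v (δ.transform (shear a b (fun j => if j ∈ δ.E then 0 else ψ j)) (fun j => if j = b then 0 else 1) c' a).c ((δ.transform (shear a b (fun j => if j ∈ δ.E then 0 else ψ j)) (fun j => if j = b then 0 else 1) c' a).f * ∏ l ∈ (δ.transform (shear a b (fun j => if j ∈ δ.E then 0 else ψ j)) (fun j => if j = b then 0 else 1) c' a).O, X l)) →
      ∃ α β γ : k, (α ≠ 0 ∨ β ≠ 0 ∨ γ ≠ 0) ∧ α • u₁ + β • u₂ + γ • u₃ = 0) := by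
  set Φ := shear a b (fun j => if j ∈ δ.E then 0 else ψ j) with hΦ
  set w : Fin (m + 1) → ℕ := fun j => if j = b then 0 else 1 with hw
  set δ' := δ.transform Φ w c' a with hδ'
  have hf : δ.f ≠ 0 := hadm.2.1.ne_zero
  have hpermB : IsBPermissible δ Φ w := isBPermissible_partialShear hadm hab hψ hE hperm
  have hconv : ∀ l, w l = 0 → c' l = 0 := fun l hl => by
    rw [hw] at hl
    rw [wb_eq_zero_iff.mp hl]; exact hcb
  have hwle : ∀ l, w l ≤ 1 := fun l => by rw [hw]; dsimp only; split_ifs <;> simp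
  have hl₀ : ∀ l, w l = 0 ↔ l = b := fun l => by rw [hw]; exact wb_eq_zero_iff
  have hψ' : ∀ j, ¬ (j = a ∨ j = b) → constantCoeff ((fun j => if j ∈ δ.E then 0 else ψ j) j) = 0 := fun j hj => by
    simp only
    split_ifs
    · exact map_zero _
    · exact hψ j hj
  have hψE : ∀ j, ¬ (j = a ∨ j = b) → constantCoeff ((fun j => if j ∈ δ.E then ψ j else 0) j) = 0 := fun j hj => by
    simp only
    split_ifs
    · exact hψ j hj
    · exact map_zero _
  have hΦs : HasSubst Φ := hasSubst_shear hψ'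
  have hord : δ.f.order = (δ.o : ℕ∞) := GraphCurve.order_f_eq_o hadm
  have hordΦ : (subst Φ δ.f).order = (δ.o : ℕ∞) := by
    rw [NCTransport.order_subst_eq_of_isUnit_det (constantCoeff_shear hψ') (isUnit_det_linMat_shear hψ'), hord]
  have hord' : δ'.f.order = (δ'.o : ℕ∞) := GraphCurve.order_f_eq_o hadm'
  have heq : δ'.o = δ.o := GraphCurve.o_transform_eq_of_head_eq hhead
  have hcard : δ'.O.card = δ.O.card := GraphCurve.card_O_transform_eq_of_head_eq hhead
  have hordg : (subst Φ (δ.f * ∏ l ∈ δ.O, X l)).order = (δ.c : ℕ∞) := Decoration.order_subst_totalO hadm hpermB.1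
  -- the partial shear fixes the old letters
  have hO : ∀ l ∈ δ.O, Φ l = X l := fun l hl => partialShear_apply_of_mem (δ.O_subset hl)
  have hprod : subst Φ (δ.f * ∏ l ∈ δ.O, X l) = subst Φ δ.f * ∏ l ∈ δ.O, X l := by
    rw [← coe_substAlgHom hΦs, map_mul, map_prod]
    simp only [coe_substAlgHom, subst_X hΦs]
    congr 1
    exact Finset.prod_congr rfl fun l hl => hO l hl
  have hstr : ∀ l ∈ δ.O, strIdx Φ l = l := fun l hl => strIdx_of_apply_eq_X (hO l hl)
  -- (P1) for `f̂` and the near data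
  have hP1f : (δ.o : ℕ∞) ≤ (subst Φ δ.f).weightedOrder w := by rw [← hordΦ]; exact hpermB.2.1
  have hnlt : ¬ ((sqfRep (δ.strict Φ w c' a)).order).toNat < δ.o := by
    rw [← Decoration.transform_o]
    exact fun h => absurd heq (ne_of_lt h)
  have hthrough := TOT2Near.Decoration.through_of_card_O_eq hnlt hcard
  obtain ⟨hfac, -, hnear⟩ := Decoration.nearData_of_o_transform_eq hpermB hconv hf hca heq
  -- the reduction vectors: the answer `c′` itself ((N3)) and `e_b` (permissibility, weight `0`)
  have ht : ∀ v, CobordantChart.initEval (fun _ : Fin (m + 1) => 1) (v + c') δ.o (subst Φ δ.f) =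
      CobordantChart.initEval (fun _ : Fin (m + 1) => 1) v δ.o (subst Φ δ.f) := fun v => by
    have h := TOT2Near.initEval_add_smul_eq_of_near_curve w c' hwle hconv a hca _ hP1f hfac hnear 1 v
    rwa [one_smul] at h
  have hpar : ∀ v, CobordantChart.initEval (fun _ : Fin (m + 1) => 1) (v + Pi.single b 1) δ.o (subst Φ δ.f) =
      CobordantChart.initEval (fun _ : Fin (m + 1) => 1) v δ.o (subst Φ δ.f) :=
    TOT2Near.initEval_add_eq_of_perm hwle hP1f fun l hl => by
      rw [Pi.single_apply, if_neg (fun h => hl ((hl₀ l).mpr h))]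
  -- the kernel of `Dir(in_o f̂)` at `{a, b, O}` is trivial: `htwo` in the move's coordinates applied to `(tL, tR, u)`
  have htwoΦ := apexPlane_subst_legal Φ (constantCoeff_shear hψ') (isUnit_det_linMat_shear hψ') (δ.f * ∏ l ∈ δ.O, X l)
    (Decoration.order_totalO hadm) htwo
  have hperm' := inOffPlaneIdeal_partialShear hψ δ.E hperm
  have hker : ∀ u : Fin (m + 1) → k,
      (∀ v, CobordantChart.initEval (fun _ : Fin (m + 1) => 1) (v + u) δ.o (subst Φ δ.f) =
        CobordantChart.initEval (fun _ : Fin (m + 1) => 1) v δ.o (subst Φ δ.f)) →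
      u a = 0 → u b = 0 → (∀ l ∈ δ.O, u l = 0) → u = 0 := by
    intro u hu hua hub huO
    have hug : ∀ v, CobordantChart.initEval (fun _ : Fin (m + 1) => 1) (v + u) δ.c (subst Φ (δ.f * ∏ l ∈ δ.O, X l)) =
        CobordantChart.initEval (fun _ : Fin (m + 1) => 1) v δ.c (subst Φ (δ.f * ∏ l ∈ δ.O, X l)) := by
      rw [hprod]; exact (TOT2Near.inv_mul_prod_X_iff hordΦ δ.O u).mpr ⟨hu, huO⟩
    have hL := tangentL_smul_inv hab hψE hordg hperm' 1
    have hR := tangentR_smul_inv hab hψE hordg hperm' 1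
    simp only [one_smul] at hL hR
    obtain ⟨α, β, γ, hne, hrel⟩ := htwoΦ _ _ _ hL hR hug
    have h1 := congr_fun hrel a
    have h2 := congr_fun hrel b
    simp only [Pi.add_apply, Pi.smul_apply, smul_eq_mul, tangentL_left, tangentR_left, tangentL_right _ hab, tangentR_right _ hab,
      hua, hub, mul_one, mul_zero, add_zero, zero_add, Pi.zero_apply] at h1 h2
    rcases hne with hα | hβ | hγ
    · exact absurd h1 hα
    · exact absurd h2 hβ
    · rw [h1, h2, zero_smul, zero_smul, zero_add, zero_add] at hrel
      exact (smul_eq_zero.mp hrel).resolve_left hγ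
  -- the successor's invariance vectors, `O′`-marked, in terms of the strict transform
  have hnew : ∀ {u : Fin (m + 1) → k}, (∀ l' ∈ δ'.O, u l' = 0) → ∀ l ∈ δ.O, u (Fin.predAbove a l.succ) = 0 := by
    intro u hu l hl
    have h := hu (Fin.predAbove a (strIdx Φ l).succ) ?_
    · rwa [hstr l hl] at h
    rw [hδ', Decoration.transform_O_of_not_lt _ _ _ _ _ hnlt]
    unfold Decoration.newLetters
    exact Finset.mem_image.mpr ⟨l, Finset.mem_filter.mpr ⟨hl, hthrough l hl⟩, rfl⟩
  intro w₁ w₂ w₃ hw₁ hw₂ hw₃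
  have hw₁' := (TOT2Near.inv_mul_prod_X_iff hord' δ'.O w₁).mp hw₁
  have hw₂' := (TOT2Near.inv_mul_prod_X_iff hord' δ'.O w₂).mp hw₂
  have hw₃' := (TOT2Near.inv_mul_prod_X_iff hord' δ'.O w₃).mp hw₃
  obtain ⟨h₁, h₁O⟩ := hw₁'
  obtain ⟨h₂, h₂O⟩ := hw₂'
  obtain ⟨h₃, h₃O⟩ := hw₃'
  rw [heq, show δ'.f = δ.strict Φ w c' a from Decoration.transform_f_eq_strict_of_o_transform_eq hpermB hconv hf hca heq] at h₁ h₂ h₃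
  exact TOT2Near.apexPlane_of_near_kernel w c' hwle hconv hl₀ a hab _ hP1f hfac hca ht hpar δ.O
    (fun u hu hua hub huO => hker u hu hua hub huO) w₁ w₂ w₃ h₁ (hnew h₁O) h₂ (hnew h₂O) h₃ (hnew h₃O)

/-- **THE CURVE-MOVE CLAUSE, UNCONDITIONAL** (part 16's `curveMove_clause` with `hpers` discharged). -/
theorem curveMove_clause' [Infinite k] {b₀ : MvPowerSeries (Fin (m + 1)) k} {δ : Decoration k m} (hadm : Admissible b₀ δ)
    {a b : Fin (m + 1)} (hab : a ≠ b) {ψ : Fin (m + 1) → MvPowerSeries (Fin 2) k} (hψ : ∀ j, ¬ (j = a ∨ j = b) → constantCoeff (ψ j) = 0)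
    (hE : ∀ l ∈ δ.E, ¬ (l = a ∨ l = b) → (X 0 : MvPowerSeries (Fin 2) k) ∣ ψ l)
    (hperm : InOffPlaneIdeal a b δ.c (subst (shear a b ψ) (δ.f * ∏ l ∈ δ.O, X l)))
    (htwo : (∀ u₁ u₂ u₃ : Fin (m + 1) → k,
      (∀ v, CobordantChart.initEval (fun _ : Fin (m + 1) => 1) (v + u₁) (δ).c ((δ).f * ∏ l ∈ (δ).O, X l) =
        CobordantChart.initEval (fun _ : Fin (m + 1) => 1) v (δ).c ((δ).f * ∏ l ∈ (δ).O, X l)) →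
      (∀ v, CobordantChart.initEval (fun _ : Fin (m + 1) => 1) (v + u₂) (δ).c ((δ).f * ∏ l ∈ (δ).O, X l) =
        CobordantChart.initEval (fun _ : Fin (m + 1) => 1) v (δ).c ((δ).f * ∏ l ∈ (δ).O, X l)) →
      (∀ v, CobordantChart.initEval (fun _ : Fin (m + 1) => 1) (v + u₃) (δ).c ((δ).f * ∏ l ∈ (δ).O, X l) =
        CobordantChart.initEval (fun _ : Fin (m + 1) => 1) v (δ).c ((δ).f * ∏ l ∈ (δ).O, X l)) →
      ∃ α β γ : k, (α ≠ 0 ∨ β ≠ 0 ∨ γ ≠ 0) ∧ α • u₁ + β • u₂ + γ • u₃ = 0)) :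
    MoveClause b₀ (shear a b (fun j => if j ∈ δ.E then 0 else ψ j)) (fun j => if j = b then 0 else 1)
      (fun b' => ∃ δ' : Decoration k m, Admissible b' δ' ∧ (δ'.head < δ.head ∨ (δ'.head = δ.head ∧ SurfState δ'))) :=
  curveMove_clause hadm hab hψ hE hperm htwo fun _ hca hcb hhead _ hadm' =>
    apexPlane_curveTransform_of_head_eq hadm hab hψ hE hperm htwo hca hcb hhead hadm'

end GraphSurf

end TameFourTupleDrop

end Summit.ResolutionOfSingularities.ResolutionOfSingularities.Theorems

end
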